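import Literature.Analysis.FluidPDE.EyinkLocalFourFifths
import HarnessLib

/-!
# Eyink's longitudinal and transverse energy balances at scale `ε` (Eyink 2003, §2, proof of Thm. 1)

Topic: Analysis/FluidPDE, the decomposition of the remaining (Euler-dependent) input of the
accepted fact `Torus.HasDuchonRobertDefect.hasFourFifthsLaw` (`DissipationAnomaly`) along the
printed proof of Eyink 2003, Thm. 1. By `EyinkUniformDefect` + `EyinkUniformDefectConsistency`
(`Torus.hasFourFifthsLaw_of_forall_hasUniformEyinkDefect`) that fact holds in dimension `d ≥ 2`
as soon as every `L³` weak Euler solution admits a *uniform Eyink defect*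
(`Torus.HasUniformEyinkDefect`: `∫∫ D_L^{ε,φ} ψ → D ψ`, `∫∫ D_T^{ε,φ} ψ → D ψ` uniformly over
spherically symmetric unit-ball mollifiers). Eyink's proof of Thm. 1 obtains these limits from
two **balance equations at scale `ε`** — (uuL-eq) and (uuT-eq) of the source — whose left-hand
sides converge at rates controlled by the `L³`/`L^{3/2}` translation moduli of `u`, `p` only.
This file **vendors the two balance equations as named facts** (their weak form against scalar
test functions supported in `(0,T) × T^d`) together with the objects they are made of; the
limit `ε → 0⁺` (uniform in the mollifier) and the assembly are proved in sibling files.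

## The printed proof (Eyink 2003, §2, pp. 4–5 of arXiv:nlin/0208004) and its transcription

With `ℓ̂ = ℓ/|ℓ|`, Eyink sets `u_L(x,t;ℓ) = (ℓ̂ ⊗ ℓ̂) u(x+ℓ,t)`, `u_T = (1 − ℓ̂ ⊗ ℓ̂) u(x+ℓ,t)`
((u-LT)), the mollified velocities `u_X^ε(x,t) = ∫ d^dℓ φ^ε(ℓ) u_X(x,t;ℓ)` ((moll-u-LT);
`Torus.eyinkVelocityL`, `Torus.eyinkVelocityT`), the kernels
`φ_T(ℓ) = (d−1) ∫_ℓ^∞ φ(ℓ') dℓ'/ℓ'`, `φ_L = φ − φ_T` ((phi-LT), printed with `d − 1 = 2`;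
`Torus.eyinkTransverseKernel`, `Torus.eyinkLongitudinalKernel`), the pressures
`p_X^ε = φ_X^ε ∗ p` ((p-LT); `Torus.eyinkPressureL`, `Torus.eyinkPressureT`) for which
`∇·Π_X^ε = ∇p_X^ε` ((Pi-p-LT), from `∇ℓ̂ = (1 − ℓ̂ ⊗ ℓ̂)/ℓ`), and the mollified quadratic and cubic
quantities `(u_X·u_X)^ε`, `((u_X·u_X)u)^ε` (`Torus.eyinkEnergyL/T`, `Torus.eyinkEnergyFluxL/T`).
"From the equations (simp-eq-u-LT) for `X = L,T`, the incompressibility conditions for `u_L^ε`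
and `u_T^ε`, and the Euler equations for `u` (in distribution sense), we derive the following
balance equations"
`2∂ₜ(u·u_L^ε) + ∇·[2(u·u_L^ε)u + ((u_L·u_L)u)^ε − (u_L·u_L)^ε u + 2p_L^ε u + 2p u_L^ε] = −(4/3) D_L^ε(u)`  (uuL-eq),
`2∂ₜ(u·u_T^ε) + ∇·[2(u·u_T^ε)u + ((u_T·u_T)u)^ε − (u_T·u_T)^ε u + 2p_T^ε u + 2p u_T^ε] = −(8/3) D_T^ε(u)`  (uuT-eq),
through the cubic identities (id-L), (id-T)
(`∫ d^dℓ {∇φ^ε·δu |δu_L|² + (2/ℓ)φ^ε δu_L|δu_T|²} = ∫ d^dℓ ∂_{ℓ_k}{ℓ̂ᵢℓ̂ⱼφ^ε(ℓ)} δuᵢδuⱼδu_k = …`).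
Tested against a scalar `ψ` supported in `(0,T) × T^d` these read
`𝓔_L^{ε,φ}(ψ) = (4/d) ∫₀ᵀ∫ D_L^{ε,φ}(u) ψ` and `𝓔_T^{ε,φ}(ψ) = (4(d−1)/d) ∫₀ᵀ∫ D_T^{ε,φ}(u) ψ` with
the **balance pairings** `Torus.eyinkBalanceL`, `Torus.eyinkBalanceT`
(`𝓔_X(ψ) = ∫∫ 2⟪u,u_X^ε⟫∂ₜψ + [2⟪u,u_X^ε⟫ − (u_X·u_X)^ε + 2p_X^ε]⟪u,∇ψ⟫ + ⟪((u_X·u_X)u)^ε,∇ψ⟫ + 2p⟪u_X^ε,∇ψ⟫`);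
the constants `4/3`, `8/3` are `1/c_L = 4/d`, `1/c_T = 4(d−1)/d` for the prefactors
`c_L = d/4`, `c_T = d/(4(d−1))` of `Torus.eyinkLongitudinalApprox`, `Torus.eyinkTransverseApprox`.
These two tested identities are the named facts `Torus.eyink_longitudinal_balance`,
`Torus.eyink_transverse_balance` below.

## Design notes

* **Dimension.** The source is written on `T³`; every display is transcribed in dimension `d`
  with `1/3 ↦ 1/d`, `2/3 ↦ (d−1)/d` (the only dimension-dependent inputs are
  `∇·ℓ̂ = (d−1)/ℓ` in (grad-Pi-L)/(grad-phi-L) and `∫ φ ℓ̂ ⊗ ℓ̂ = d⁻¹ 1` in (third-delta)),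
  exactly as `EyinkLocalFourFifths` records the general-`d` prefactors; the facts require
  `2 ≤ Fintype.card d` (Novack 2024, Thm. 1 and §2 Step 2 prove the `d`-dimensional laws,
  `d ≥ 2`, along a different regularisation). The accepted 4/5-law fact quantifies over all `d`.
* **Conventions** follow `DissipationAnomaly` / `EyinkLocalFourFifths`: separation vectors
  `ξ ∈ ℝ^d` act on `T^d` through the covering map (`x + Torus.proj ξ`, as in `Torus.increment`),
  all `ξ`-integrals are Bochner integrals over `ℝ^d` (junk `0` off integrability — for
  `u(t) ∈ L³`, `p(t) ∈ L^{3/2}` they are honest integrals at a.e. `x`: the kernels `φ^ε`,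
  `φ^ε ℓ̂⊗ℓ̂` are bounded with compact support and `φ_L^ε`, `φ_T^ε` have a logarithmic
  singularity at `0`, in `L^q` for all `q < ∞` when `d ≥ 2`), `ℓ̂ = ‖ξ‖⁻¹ • ξ` with junk `0` at
  `ξ = 0` (a null set), and `φ_T(ξ) = (d−1)∫_{s>1} φ(sξ) ds/s` (the substitution `ℓ' = s|ξ|` in
  (phi-LT), which needs no radial profile; junk at `ξ = 0`).
* The distributional Euler solution is the tree's pressure-explicit class
  `Torus.IsDistributionalNSSolutionOn T 0 0 u p` (test fields supported in `(0,T)`), with the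
  joint bounds `∫⁻₍₀,T₎∫⁻ ‖u‖ₑ³ < ∞`, `∫⁻₍₀,T₎∫⁻ ‖p‖ₑ^{3/2} < ∞` of `DuchonRobertLocalBalance`; for a
  pressure-free `L³` weak Euler solution the pressure is supplied by
  `Torus.exists_pressure_of_tendsto_L3` (`DuchonRobertInviscidLimit`; Eyink: "`p ∈ L^{3/2}` by the
  Calderón–Zygmund inequality").
* The scale is any `ε > 0` (Eyink restricts `ε` only for (third-delta), which is not part of the
  identities; the covering-map convention makes wide kernels meaningful).
* Signs: pairing `2∂ₜ(u·u_X^ε) + ∇·J_X = −c_X⁻¹ D_X^ε` with `ψ` gives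
  `−2∫∫(u·u_X^ε)∂ₜψ − ∫∫ J_X·∇ψ = −c_X⁻¹∫∫ D_X^ε ψ`, i.e. `𝓔_X(ψ) = c_X⁻¹ ∫∫ D_X^ε ψ`; as `ε → 0`
  this is consistent with `∫∫ D_X^ε ψ → D(u)(ψ) = ∫∫ ½|u|²∂ₜψ + (½|u|²+p)⟪u,∇ψ⟫`
  (`Torus.HasLocalEnergyBalance`, Duchon–Robert 2000, Prop. 2), since
  `u_L^ε → u/d`, `u_T^ε → (d−1)u/d`, `p_L^ε → p/d`, `p_T^ε → (d−1)p/d` and the commutators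
  `((u_X·u_X)u)^ε − (u_X·u_X)^ε u → 0`. The cubic bookkeeping of (id-L)/(id-T) was re-derived
  independently (expansion of `δuᵢδuⱼδu_k` in the eight monomials against `∂_kMᵢⱼ`, the terms
  `bᵢbⱼa_k`, `bᵢbⱼb_k` vanishing by `div u = 0` and `∫∇M = 0`).
* Not here: the limits `ε → 0⁺` (uniform over unit-ball mollifiers) of the six terms of `𝓔_X`
  and the assembly into `HasUniformEyinkDefect` (sibling files), nor the discharge of the two
  facts (the matrix-kernel form of Duchon–Robert's computation, `DuchonRobertLocalBalance`,
  `DuchonRobertCubicIdentity`).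

## References

* G. L. Eyink, *Local 4/5-law and energy dissipation anomaly in turbulence*, Nonlinearity 16
  (2003) 137–145, doi:10.1088/0951-7715/16/1/309 = arXiv:nlin/0208004: §2, Thm. 1 and its proof —
  (u-LT), (moll-u-LT), (eq-u-LT), (Pi-LT), (Pi-p-LT), (p-LT), (phi-LT), (grad-Pi-L),
  (grad-phi-L), (simp-eq-u-LT), (grad-u-L), (div-u-L), (uuL-eq), (uuT-eq), (id-L), (id-T) (the
  `\label`s of the arXiv source; the held text carries no equation numbers). [Eyink2003]
* M. Novack, *Scaling laws and exact results in turbulence*, Nonlinearity 37 (2024) 095002 =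
  arXiv:2310.01375: Thm. 1 (`d ≥ 2`) and §2 Step 2 (the tensor kernels `T_L = y⊗y/|y|²`,
  `T_T = 1 − T_L` and `∂ᵢ(T_L^{ik}φ) = ∂_k(φ − (d−1)∫_{|y|}^∞ φ(|ȳ|)/|ȳ| dȳ)`). [Novack2024]
* J. Duchon, R. Robert, Nonlinearity 13 (2000) 249–255, proof of Prop. 1 (the scalar-kernel
  computation that (uuL-eq)/(uuT-eq) refine). [DuchonRobert2000]
-/

noncomputable section

open MeasureTheory TopologicalSpace Set Function Filter Topology Metric
open scoped InnerProductSpace RealInnerProductSpace ENNReal NNReal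

namespace Literature.Analysis.FluidPDE.Torus

variable {d : Type*} [Fintype d]

/-! ## Eyink's kernels `φ_T`, `φ_L` -/

section Kernels

variable (d) in
/-- **Eyink's transverse kernel** `φ_T(ξ) = (d−1) ∫_{|ξ|}^∞ φ(ℓ') dℓ'/ℓ' = (d−1) ∫_{s>1} φ(sξ) ds/s`
of a (spherically symmetric) kernel `φ` (Eyink 2003, (phi-LT), printed with `d − 1 = 2` on `T³`):
the radial kernel with `∇·[(1 − ℓ̂⊗ℓ̂)φ] = ∇φ_T`, so that `∇·Π_T^ε = ∇p_T^ε` ((Pi-p-LT)). Written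
through the substitution `ℓ' = s|ξ|`, which needs no radial profile; Bochner integral over
`s ∈ (1,∞)` (junk `0` at `ξ = 0`, where the printed kernel has its logarithmic singularity). [cite: Eyink2003, §2 (phi-LT)] -/
def eyinkTransverseKernel (φ : EuclideanSpace ℝ d → ℝ) (ξ : EuclideanSpace ℝ d) : ℝ :=
  ((Fintype.card d : ℝ) - 1) * ∫ s in Ioi (1 : ℝ), s⁻¹ * φ (s • ξ)

variable (d) in
/-- **Eyink's longitudinal kernel** `φ_L = φ − φ_T` (Eyink 2003, (phi-LT)): the radial kernel
with `∇·[(ℓ̂⊗ℓ̂)φ] = ∇φ_L` ((grad-Pi-L)–(grad-phi-L): `φ_L' = φ' + (d−1)φ/ℓ`), so that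
`∇·Π_L^ε = ∇p_L^ε`. [cite: Eyink2003, §2 (phi-LT)] -/
def eyinkLongitudinalKernel (φ : EuclideanSpace ℝ d → ℝ) (ξ : EuclideanSpace ℝ d) : ℝ :=
  φ ξ - eyinkTransverseKernel d φ ξ

/-- Unfolding `eyinkTransverseKernel`. [folklore] -/
theorem eyinkTransverseKernel_apply (φ : EuclideanSpace ℝ d → ℝ) (ξ : EuclideanSpace ℝ d) :
    eyinkTransverseKernel d φ ξ = ((Fintype.card d : ℝ) - 1) * ∫ s in Ioi (1 : ℝ), s⁻¹ * φ (s • ξ) :=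
  rfl

/-- Unfolding `eyinkLongitudinalKernel`. [folklore] -/
theorem eyinkLongitudinalKernel_apply (φ : EuclideanSpace ℝ d → ℝ) (ξ : EuclideanSpace ℝ d) :
    eyinkLongitudinalKernel d φ ξ = φ ξ - eyinkTransverseKernel d φ ξ :=
  rfl

/-- `φ_L + φ_T = φ` (Eyink 2003, (phi-LT); whence `p_L^ε + p_T^ε = p^ε`). [cite: Eyink2003, §2 (phi-LT)] -/
theorem eyinkLongitudinalKernel_add_eyinkTransverseKernel (φ : EuclideanSpace ℝ d → ℝ)
    (ξ : EuclideanSpace ℝ d) :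
    eyinkLongitudinalKernel d φ ξ + eyinkTransverseKernel d φ ξ = φ ξ := by
  rw [eyinkLongitudinalKernel_apply, sub_add_cancel]

/-- The kernels of the zero profile vanish. [folklore] -/
@[simp]
theorem eyinkTransverseKernel_zero (ξ : EuclideanSpace ℝ d) :
    eyinkTransverseKernel d (0 : EuclideanSpace ℝ d → ℝ) ξ = 0 := by
  simp [eyinkTransverseKernel]

/-- **Rescaling commutes with `φ ↦ φ_T`**: `(φ^ε)_T = (φ_T)^ε` (`φ^ε = ε^{-d}φ(·/ε)`,
`FluidPDE.mollifierScale`; Eyink writes `φ_X^ε` for either). [folklore] -/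
theorem eyinkTransverseKernel_mollifierScale (φ : EuclideanSpace ℝ d → ℝ) (ε : ℝ) (ξ : EuclideanSpace ℝ d) :
    eyinkTransverseKernel d (FluidPDE.mollifierScale ε φ) ξ =
      FluidPDE.mollifierScale ε (eyinkTransverseKernel d φ) ξ := by
  simp only [eyinkTransverseKernel_apply, FluidPDE.mollifierScale_apply, smul_smul]
  rw [← integral_const_mul, ← integral_const_mul, ← integral_const_mul]
  refine setIntegral_congr_fun measurableSet_Ioi fun s _ => ?_
  rw [mul_comm s ε⁻¹]
  ring

/-- `(φ^ε)_L = (φ_L)^ε`. [folklore] -/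
theorem eyinkLongitudinalKernel_mollifierScale (φ : EuclideanSpace ℝ d → ℝ) (ε : ℝ)
    (ξ : EuclideanSpace ℝ d) :
    eyinkLongitudinalKernel d (FluidPDE.mollifierScale ε φ) ξ =
      FluidPDE.mollifierScale ε (eyinkLongitudinalKernel d φ) ξ := by
  rw [eyinkLongitudinalKernel_apply, eyinkTransverseKernel_mollifierScale, FluidPDE.mollifierScale_apply,
    FluidPDE.mollifierScale_apply, FluidPDE.mollifierScale_apply, eyinkLongitudinalKernel_apply, mul_sub]

end Kernels

/-! ## The mollified longitudinal / transverse velocities, energies, energy fluxes and pressures -/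

section Objects

variable {F : Type*}

/-- **Eyink's mollified longitudinal velocity**
`u_L^ε(x) = ∫ d^dξ φ^ε(ξ) (ξ̂ ⊗ ξ̂) u(x + ξ) = ∫ φ^ε(ξ) ⟪u(x+ξ), ξ̂⟫ ξ̂ dξ`, `ξ̂ = ξ/|ξ|`, of a
velocity slice `u : T^d → ℝ^d` (Eyink 2003, (u-LT)–(moll-u-LT); `ξ` acts through the covering
map, Bochner integral over `ℝ^d`). [cite: Eyink2003, §2 (moll-u-LT)] -/
def eyinkVelocityL (φ : EuclideanSpace ℝ d → ℝ) (ε : ℝ) (u : UnitAddTorus d → EuclideanSpace ℝ d)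
    (x : UnitAddTorus d) : EuclideanSpace ℝ d :=
  ∫ ξ, (FluidPDE.mollifierScale ε φ ξ * ⟪u (x + FunctionSpaces.Torus.proj ξ), ‖ξ‖⁻¹ • ξ⟫) • (‖ξ‖⁻¹ • ξ)

/-- **Eyink's mollified transverse velocity**
`u_T^ε(x) = ∫ d^dξ φ^ε(ξ) (1 − ξ̂ ⊗ ξ̂) u(x + ξ) = ∫ φ^ε(ξ) [u(x+ξ) − ⟪u(x+ξ), ξ̂⟫ ξ̂] dξ`
(Eyink 2003, (u-LT)–(moll-u-LT); `u_L^ε + u_T^ε = u^ε`). [cite: Eyink2003, §2 (moll-u-LT)] -/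
def eyinkVelocityT (φ : EuclideanSpace ℝ d → ℝ) (ε : ℝ) (u : UnitAddTorus d → EuclideanSpace ℝ d)
    (x : UnitAddTorus d) : EuclideanSpace ℝ d :=
  ∫ ξ, FluidPDE.mollifierScale ε φ ξ •
    (u (x + FunctionSpaces.Torus.proj ξ) -
      ⟪u (x + FunctionSpaces.Torus.proj ξ), ‖ξ‖⁻¹ • ξ⟫ • (‖ξ‖⁻¹ • ξ))

/-- **The mollified longitudinal energy** `(u_L·u_L)^ε(x) = ∫ φ^ε(ξ) ⟪u(x+ξ), ξ̂⟫² dξ`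
(Eyink 2003, (uuL-eq): `u_L·u_L = (ℓ̂·u(x+ℓ))²`). [cite: Eyink2003, §2 (uuL-eq)] -/
def eyinkEnergyL (φ : EuclideanSpace ℝ d → ℝ) (ε : ℝ) (u : UnitAddTorus d → EuclideanSpace ℝ d)
    (x : UnitAddTorus d) : ℝ :=
  ∫ ξ, FluidPDE.mollifierScale ε φ ξ * ⟪u (x + FunctionSpaces.Torus.proj ξ), ‖ξ‖⁻¹ • ξ⟫ ^ 2

/-- **The mollified transverse energy** `(u_T·u_T)^ε(x) = ∫ φ^ε(ξ) |u(x+ξ) − ⟪u(x+ξ), ξ̂⟫ξ̂|² dξ`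
(Eyink 2003, (uuT-eq)). [cite: Eyink2003, §2 (uuT-eq)] -/
def eyinkEnergyT (φ : EuclideanSpace ℝ d → ℝ) (ε : ℝ) (u : UnitAddTorus d → EuclideanSpace ℝ d)
    (x : UnitAddTorus d) : ℝ :=
  ∫ ξ, FluidPDE.mollifierScale ε φ ξ *
    ‖u (x + FunctionSpaces.Torus.proj ξ) - ⟪u (x + FunctionSpaces.Torus.proj ξ), ‖ξ‖⁻¹ • ξ⟫ • (‖ξ‖⁻¹ • ξ)‖ ^ 2

/-- **The mollified longitudinal energy flux** `((u_L·u_L)u)^ε(x) = ∫ φ^ε(ξ) ⟪u(x+ξ), ξ̂⟫² u(x+ξ) dξ`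
(Eyink 2003, (uuL-eq), (id-L)). [cite: Eyink2003, §2 (uuL-eq)] -/
def eyinkEnergyFluxL (φ : EuclideanSpace ℝ d → ℝ) (ε : ℝ) (u : UnitAddTorus d → EuclideanSpace ℝ d)
    (x : UnitAddTorus d) : EuclideanSpace ℝ d :=
  ∫ ξ, (FluidPDE.mollifierScale ε φ ξ * ⟪u (x + FunctionSpaces.Torus.proj ξ), ‖ξ‖⁻¹ • ξ⟫ ^ 2) •
    u (x + FunctionSpaces.Torus.proj ξ)

/-- **The mollified transverse energy flux**
`((u_T·u_T)u)^ε(x) = ∫ φ^ε(ξ) |u(x+ξ) − ⟪u(x+ξ), ξ̂⟫ξ̂|² u(x+ξ) dξ` (Eyink 2003, (uuT-eq), (id-T)). [cite: Eyink2003, §2 (uuT-eq)] -/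
def eyinkEnergyFluxT (φ : EuclideanSpace ℝ d → ℝ) (ε : ℝ) (u : UnitAddTorus d → EuclideanSpace ℝ d)
    (x : UnitAddTorus d) : EuclideanSpace ℝ d :=
  ∫ ξ, (FluidPDE.mollifierScale ε φ ξ *
      ‖u (x + FunctionSpaces.Torus.proj ξ) -
        ⟪u (x + FunctionSpaces.Torus.proj ξ), ‖ξ‖⁻¹ • ξ⟫ • (‖ξ‖⁻¹ • ξ)‖ ^ 2) •
    u (x + FunctionSpaces.Torus.proj ξ)

/-- **Eyink's longitudinal pressure** `p_L^ε(x) = (φ_L^ε ∗ p)(x) = ∫ φ_L^ε(ξ) p(x+ξ) dξ`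
(Eyink 2003, (p-LT), with `(Pi-p-LT)`: `∇·Π_L^ε = ∇p_L^ε`). [cite: Eyink2003, §2 (p-LT)] -/
def eyinkPressureL (φ : EuclideanSpace ℝ d → ℝ) (ε : ℝ) (p : UnitAddTorus d → ℝ) (x : UnitAddTorus d) : ℝ :=
  ∫ ξ, eyinkLongitudinalKernel d (FluidPDE.mollifierScale ε φ) ξ * p (x + FunctionSpaces.Torus.proj ξ)

/-- **Eyink's transverse pressure** `p_T^ε(x) = (φ_T^ε ∗ p)(x) = ∫ φ_T^ε(ξ) p(x+ξ) dξ`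
(Eyink 2003, (p-LT), (pT-eq)). [cite: Eyink2003, §2 (p-LT)] -/
def eyinkPressureT (φ : EuclideanSpace ℝ d → ℝ) (ε : ℝ) (p : UnitAddTorus d → ℝ) (x : UnitAddTorus d) : ℝ :=
  ∫ ξ, eyinkTransverseKernel d (FluidPDE.mollifierScale ε φ) ξ * p (x + FunctionSpaces.Torus.proj ξ)

/-- Unfolding `eyinkVelocityL`. [folklore] -/
theorem eyinkVelocityL_apply (φ : EuclideanSpace ℝ d → ℝ) (ε : ℝ) (u : UnitAddTorus d → EuclideanSpace ℝ d)
    (x : UnitAddTorus d) :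
    eyinkVelocityL φ ε u x =
      ∫ ξ, (FluidPDE.mollifierScale ε φ ξ * ⟪u (x + FunctionSpaces.Torus.proj ξ), ‖ξ‖⁻¹ • ξ⟫) • (‖ξ‖⁻¹ • ξ) :=
  rfl

/-- Unfolding `eyinkVelocityT`. [folklore] -/
theorem eyinkVelocityT_apply (φ : EuclideanSpace ℝ d → ℝ) (ε : ℝ) (u : UnitAddTorus d → EuclideanSpace ℝ d)
    (x : UnitAddTorus d) :
    eyinkVelocityT φ ε u x =
      ∫ ξ, FluidPDE.mollifierScale ε φ ξ •
        (u (x + FunctionSpaces.Torus.proj ξ) -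
          ⟪u (x + FunctionSpaces.Torus.proj ξ), ‖ξ‖⁻¹ • ξ⟫ • (‖ξ‖⁻¹ • ξ)) :=
  rfl

/-- Unfolding `eyinkPressureL`. [folklore] -/
theorem eyinkPressureL_apply (φ : EuclideanSpace ℝ d → ℝ) (ε : ℝ) (p : UnitAddTorus d → ℝ)
    (x : UnitAddTorus d) :
    eyinkPressureL φ ε p x =
      ∫ ξ, eyinkLongitudinalKernel d (FluidPDE.mollifierScale ε φ) ξ * p (x + FunctionSpaces.Torus.proj ξ) :=
  rfl

/-- Unfolding `eyinkPressureT`. [folklore] -/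
theorem eyinkPressureT_apply (φ : EuclideanSpace ℝ d → ℝ) (ε : ℝ) (p : UnitAddTorus d → ℝ)
    (x : UnitAddTorus d) :
    eyinkPressureT φ ε p x =
      ∫ ξ, eyinkTransverseKernel d (FluidPDE.mollifierScale ε φ) ξ * p (x + FunctionSpaces.Torus.proj ξ) :=
  rfl

/-- All longitudinal/transverse objects of the zero velocity field vanish. [folklore] -/
@[simp]
theorem eyinkVelocityL_zero (φ : EuclideanSpace ℝ d → ℝ) (ε : ℝ) (x : UnitAddTorus d) :
    eyinkVelocityL φ ε (0 : UnitAddTorus d → EuclideanSpace ℝ d) x = 0 := by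
  simp [eyinkVelocityL]

/-- `u_T^ε` of the zero field vanishes. [folklore] -/
@[simp]
theorem eyinkVelocityT_zero (φ : EuclideanSpace ℝ d → ℝ) (ε : ℝ) (x : UnitAddTorus d) :
    eyinkVelocityT φ ε (0 : UnitAddTorus d → EuclideanSpace ℝ d) x = 0 := by
  simp [eyinkVelocityT]

/-- `(u_L·u_L)^ε` of the zero field vanishes. [folklore] -/
@[simp]
theorem eyinkEnergyL_zero (φ : EuclideanSpace ℝ d → ℝ) (ε : ℝ) (x : UnitAddTorus d) :
    eyinkEnergyL φ ε (0 : UnitAddTorus d → EuclideanSpace ℝ d) x = 0 := by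
  simp [eyinkEnergyL]

/-- `(u_T·u_T)^ε` of the zero field vanishes. [folklore] -/
@[simp]
theorem eyinkEnergyT_zero (φ : EuclideanSpace ℝ d → ℝ) (ε : ℝ) (x : UnitAddTorus d) :
    eyinkEnergyT φ ε (0 : UnitAddTorus d → EuclideanSpace ℝ d) x = 0 := by
  simp [eyinkEnergyT]

/-- `((u_L·u_L)u)^ε` of the zero field vanishes. [folklore] -/
@[simp]
theorem eyinkEnergyFluxL_zero (φ : EuclideanSpace ℝ d → ℝ) (ε : ℝ) (x : UnitAddTorus d) :
    eyinkEnergyFluxL φ ε (0 : UnitAddTorus d → EuclideanSpace ℝ d) x = 0 := by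
  simp [eyinkEnergyFluxL]

/-- `((u_T·u_T)u)^ε` of the zero field vanishes. [folklore] -/
@[simp]
theorem eyinkEnergyFluxT_zero (φ : EuclideanSpace ℝ d → ℝ) (ε : ℝ) (x : UnitAddTorus d) :
    eyinkEnergyFluxT φ ε (0 : UnitAddTorus d → EuclideanSpace ℝ d) x = 0 := by
  simp [eyinkEnergyFluxT]

/-- The pressures of the zero pressure vanish. [folklore] -/
@[simp]
theorem eyinkPressureL_zero (φ : EuclideanSpace ℝ d → ℝ) (ε : ℝ) (x : UnitAddTorus d) :
    eyinkPressureL φ ε (0 : UnitAddTorus d → ℝ) x = 0 := by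
  simp [eyinkPressureL]

/-- `p_T^ε` of the zero pressure vanishes. [folklore] -/
@[simp]
theorem eyinkPressureT_zero (φ : EuclideanSpace ℝ d → ℝ) (ε : ℝ) (x : UnitAddTorus d) :
    eyinkPressureT φ ε (0 : UnitAddTorus d → ℝ) x = 0 := by
  simp [eyinkPressureT]

end Objects

/-! ## The balance pairings `𝓔_L^{ε,φ}(ψ)`, `𝓔_T^{ε,φ}(ψ)` -/

section Pairings

/-- **Eyink's longitudinal balance pairing** at scale `ε` (the left-hand side of (uuL-eq) tested
against a scalar `ψ`, after one integration by parts onto `ψ`):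
`𝓔_L^{ε,φ}(ψ) = ∫₀ᵀ∫ 2⟪u,u_L^ε⟫∂ₜψ + [2⟪u,u_L^ε⟫ − (u_L·u_L)^ε + 2p_L^ε]⟪u,∇ψ⟫ + ⟪((u_L·u_L)u)^ε, ∇ψ⟫ + 2p⟪u_L^ε,∇ψ⟫`,
i.e. `−⟨2∂ₜ(u·u_L^ε) + ∇·[2(u·u_L^ε)u + ((u_L·u_L)u)^ε − (u_L·u_L)^ε u + 2p_L^ε u + 2p u_L^ε], ψ⟩`
(Eyink 2003, (uuL-eq)). Iterated Bochner integrals over `(0,T) × T^d`. [cite: Eyink2003, §2 (uuL-eq)] -/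
def eyinkBalanceL (T : ℝ) (u : ℝ → UnitAddTorus d → EuclideanSpace ℝ d) (p : ℝ → UnitAddTorus d → ℝ)
    (φ : EuclideanSpace ℝ d → ℝ) (ε : ℝ) (ψ : ℝ → UnitAddTorus d → ℝ) : ℝ :=
  ∫ t in Ioo 0 T, ∫ x,
    (2 * ⟪u t x, eyinkVelocityL φ ε (u t) x⟫ * FunctionSpaces.Torus.timeDeriv ψ t x +
      (2 * ⟪u t x, eyinkVelocityL φ ε (u t) x⟫ - eyinkEnergyL φ ε (u t) x +
          2 * eyinkPressureL φ ε (p t) x) * ⟪u t x, FunctionSpaces.Torus.gradient (ψ t) x⟫ +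
      ⟪eyinkEnergyFluxL φ ε (u t) x, FunctionSpaces.Torus.gradient (ψ t) x⟫ +
      2 * p t x * ⟪eyinkVelocityL φ ε (u t) x, FunctionSpaces.Torus.gradient (ψ t) x⟫)

/-- **Eyink's transverse balance pairing** at scale `ε` (the left-hand side of (uuT-eq) tested
against `ψ`):
`𝓔_T^{ε,φ}(ψ) = ∫₀ᵀ∫ 2⟪u,u_T^ε⟫∂ₜψ + [2⟪u,u_T^ε⟫ − (u_T·u_T)^ε + 2p_T^ε]⟪u,∇ψ⟫ + ⟪((u_T·u_T)u)^ε, ∇ψ⟫ + 2p⟪u_T^ε,∇ψ⟫`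
(Eyink 2003, (uuT-eq)). [cite: Eyink2003, §2 (uuT-eq)] -/
def eyinkBalanceT (T : ℝ) (u : ℝ → UnitAddTorus d → EuclideanSpace ℝ d) (p : ℝ → UnitAddTorus d → ℝ)
    (φ : EuclideanSpace ℝ d → ℝ) (ε : ℝ) (ψ : ℝ → UnitAddTorus d → ℝ) : ℝ :=
  ∫ t in Ioo 0 T, ∫ x,
    (2 * ⟪u t x, eyinkVelocityT φ ε (u t) x⟫ * FunctionSpaces.Torus.timeDeriv ψ t x +
      (2 * ⟪u t x, eyinkVelocityT φ ε (u t) x⟫ - eyinkEnergyT φ ε (u t) x +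
          2 * eyinkPressureT φ ε (p t) x) * ⟪u t x, FunctionSpaces.Torus.gradient (ψ t) x⟫ +
      ⟪eyinkEnergyFluxT φ ε (u t) x, FunctionSpaces.Torus.gradient (ψ t) x⟫ +
      2 * p t x * ⟪eyinkVelocityT φ ε (u t) x, FunctionSpaces.Torus.gradient (ψ t) x⟫)

/-- The longitudinal balance pairing of the zero solution vanishes. [folklore] -/
@[simp]
theorem eyinkBalanceL_zero (T : ℝ) (p : ℝ → UnitAddTorus d → ℝ) (φ : EuclideanSpace ℝ d → ℝ) (ε : ℝ)
    (ψ : ℝ → UnitAddTorus d → ℝ) :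
    eyinkBalanceL T (0 : ℝ → UnitAddTorus d → EuclideanSpace ℝ d) p φ ε ψ = 0 := by
  simp [eyinkBalanceL]

/-- The transverse balance pairing of the zero solution vanishes. [folklore] -/
@[simp]
theorem eyinkBalanceT_zero (T : ℝ) (p : ℝ → UnitAddTorus d → ℝ) (φ : EuclideanSpace ℝ d → ℝ) (ε : ℝ)
    (ψ : ℝ → UnitAddTorus d → ℝ) :
    eyinkBalanceT T (0 : ℝ → UnitAddTorus d → EuclideanSpace ℝ d) p φ ε ψ = 0 := by
  simp [eyinkBalanceT]

end Pairings

/-! ## The two balance equations as named facts -/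

section Facts

variable [DecidableEq d]

/-- **Eyink's longitudinal energy balance at scale `ε`** (Eyink 2003, §2, proof of Thm. 1,
(uuL-eq): "From the equations (simp-eq-u-LT) for `X = L,T`, the incompressibility conditions for
`u_L^ε` and `u_T^ε`, and the Euler equations for `u` (in distribution sense), we derive the
following balance equations
`2∂ₜ(u·u_L^ε) + ∇·[2(u·u_L^ε)u + ((u_L·u_L)u)^ε − (u_L·u_L)^ε u + 2p_L^ε u + 2p u_L^ε] = −(4/3) D_L^ε(u)`",
obtained through the cubic identity (id-L) and `∇·Π_L^ε = ∇p_L^ε` (Pi-p-LT)). Transcription on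
`T^d × (0,T)`, `d ≥ 2` (printed for `d = 3`; `4/3 = 1/c_L ↦ 4/d`): for a distributional
(pressure-explicit, unforced) Euler solution `(u, p)` (`Torus.IsDistributionalNSSolutionOn T 0 0 u p`)
with `u ∈ L³_{t,x}`, `p ∈ L^{3/2}_{t,x}`, a spherically symmetric mollifier `φ`
(`FluidPDE.IsMollifier`), a scale `ε > 0` and a scalar test function `ψ` supported in
`(0,T) × T^d`, the balance tested against `ψ` reads
`𝓔_L^{ε,φ}(ψ) = (4/d) ∫₀ᵀ∫ D_L^{ε,φ}(u) ψ` (`Torus.eyinkBalanceL`, `Torus.eyinkLongitudinalApprox`). [cite: Eyink2003, §2 (uuL-eq)] -/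
def eyink_longitudinal_balance : Prop :=
  ∀ {T : ℝ} {u : ℝ → UnitAddTorus d → EuclideanSpace ℝ d} {p : ℝ → UnitAddTorus d → ℝ}
    (_hd : 2 ≤ Fintype.card d)
    (_hsol : IsDistributionalNSSolutionOn T 0 0 u p)
    (_hu3 : ∫⁻ t in Ioo 0 T, ∫⁻ x, ‖u t x‖ₑ ^ 3 < ⊤)
    (_hp : ∫⁻ t in Ioo 0 T, ∫⁻ x, ‖p t x‖ₑ ^ (3 / 2 : ℝ) < ⊤)
    {φ : EuclideanSpace ℝ d → ℝ} (_hφ : FluidPDE.IsMollifier φ) (_hrad : ∀ ξ η, ‖ξ‖ = ‖η‖ → φ ξ = φ η)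
    {ε : ℝ} (_hε : 0 < ε)
    {ψ : ℝ → UnitAddTorus d → ℝ} (_hψ : FunctionSpaces.Torus.IsSpaceTimeTestIoo T ψ),
    eyinkBalanceL T u p φ ε ψ =
      4 / (Fintype.card d : ℝ) * ∫ t in Ioo 0 T, ∫ x, eyinkLongitudinalApprox φ ε (u t) x * ψ t x

/-- **Eyink's transverse energy balance at scale `ε`** (Eyink 2003, §2, proof of Thm. 1,
(uuT-eq):
`2∂ₜ(u·u_T^ε) + ∇·[2(u·u_T^ε)u + ((u_T·u_T)u)^ε − (u_T·u_T)^ε u + 2p_T^ε u + 2p u_T^ε] = −(8/3) D_T^ε(u)`,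
through (id-T) and `∇·Π_T^ε = ∇p_T^ε`). Transcription on `T^d × (0,T)`, `d ≥ 2` (printed for
`d = 3`; `8/3 = 1/c_T ↦ 4(d−1)/d`), same hypotheses as `eyink_longitudinal_balance`:
`𝓔_T^{ε,φ}(ψ) = (4(d−1)/d) ∫₀ᵀ∫ D_T^{ε,φ}(u) ψ` (`Torus.eyinkBalanceT`, `Torus.eyinkTransverseApprox`). [cite: Eyink2003, §2 (uuT-eq)] -/
def eyink_transverse_balance : Prop :=
  ∀ {T : ℝ} {u : ℝ → UnitAddTorus d → EuclideanSpace ℝ d} {p : ℝ → UnitAddTorus d → ℝ}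
    (_hd : 2 ≤ Fintype.card d)
    (_hsol : IsDistributionalNSSolutionOn T 0 0 u p)
    (_hu3 : ∫⁻ t in Ioo 0 T, ∫⁻ x, ‖u t x‖ₑ ^ 3 < ⊤)
    (_hp : ∫⁻ t in Ioo 0 T, ∫⁻ x, ‖p t x‖ₑ ^ (3 / 2 : ℝ) < ⊤)
    {φ : EuclideanSpace ℝ d → ℝ} (_hφ : FluidPDE.IsMollifier φ) (_hrad : ∀ ξ η, ‖ξ‖ = ‖η‖ → φ ξ = φ η)
    {ε : ℝ} (_hε : 0 < ε)
    {ψ : ℝ → UnitAddTorus d → ℝ} (_hψ : FunctionSpaces.Torus.IsSpaceTimeTestIoo T ψ),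
    eyinkBalanceT T u p φ ε ψ =
      4 * ((Fintype.card d : ℝ) - 1) / Fintype.card d *
        ∫ t in Ioo 0 T, ∫ x, eyinkTransverseApprox φ ε (u t) x * ψ t x

/-- In `d = 3` the two constants are the printed `4/3` and `8/3` (Eyink 2003, (uuL-eq),
(uuT-eq)). [cite: Eyink2003, §2 (uuL-eq)–(uuT-eq)] -/
theorem eyinkBalance_constants_fin_three :
    (4 : ℝ) / (Fintype.card (Fin 3) : ℝ) = 4 / 3 ∧
      4 * ((Fintype.card (Fin 3) : ℝ) - 1) / Fintype.card (Fin 3) = 8 / 3 := by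
  norm_num [Fintype.card_fin]

end Facts

end Literature.Analysis.FluidPDE.Torus
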